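import Summits.CriticalPhenomena.PercolationContinuityZ3.Theorems.PercNearOneGluingNoHeavyLowerTailAPLNonuniformPaths
import Summits.CriticalPhenomena.PercolationContinuityZ3.Theorems.PercNearOneGluingAdditiveGluingOffObserverFibres
import Literature.Probability.LatticeModels.ProdBernoulliClusterLocality
import HarnessLib

/-!
# `NoHeavyLowerTail` (stmt-CriticalPhenomena-4575) — non-uniform APL, part II: fibres of `T_b`, the cluster Markov factorisation,
# and the fibre sums of `m, A, G, X`

Support file (prover seat `prim-cert-1`, gen 16; `--supports stmt-CriticalPhenomena-4575`).  No definitions, no named facts, no sorries.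
Part II of `…APLNonuniformDecoupling` (part I: `…APLNonuniformPaths`).

SETTING (as in part I, on `Fin n` with `μ = prodBernoulli w`).  For a finset `T`: the fibre `{T_b = T}`; the attachment events
`Att_b(T) = {∃ s ∈ S, ∃ t ∈ T, s(s,t) open}` and `Att_c(T) = {∃ s ∈ S, ∃ t ∈ (cluster of c among the pairs inside Sᶜ ∖ T), s(s,t) open}`.
* `{T_b = T}`, `Att_b(T)`, `Att_c(T)` are determined by three pairwise DISJOINT classes of pairs (pairs inside `Sᶜ` meeting `T`; pairs
  from `S` into `T`; pairs avoiding `T` with a vertex outside `S`), hence (Grimmett §2.2 / BHK Lemma 2.3, tree: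
  `prodBernoulli_real_inter_of_determinedBy_disjoint`) `μ({T_b=T} ∩ Att_b ∩ Att_c) = μ(T_b=T)·μ(Att_b)·μ(Att_c)` (`real_fibS_attach_attach`);
* the fibres partition the space (`real_eq_sum_fibS`, via `sigmaRec_sum_preimage_inter`);
* with `D° = {c ∉ T_b}`, `p_T = μ(T_b = T, c ∉ T_b)`, `α(T) = μ(Att_b T)`, `Γ(T) = μ(Att_c T)`:
  `μ(D° ∩ EX_b ∩ EX_c) = Σ_T α(T)Γ(T) p_T`, `μ(D° ∩ EX_b) = Σ_T α(T) p_T`, `μ(D° ∩ EX_c) = Σ_T Γ(T) p_T`, `μ(D°) = Σ_T p_T`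
  (`real_offD_exb_exc_eq_sum`, `real_offD_exb_eq_sum`, `real_offD_exc_eq_sum`, `real_offD_eq_sum`).
[cite: VandenbergHaggstromKahn2005, Lemma 2.3 (domain Markov property at a cluster)]  [this work]
-/

noncomputable section

namespace Summit.CriticalPhenomena.PercolationContinuityZ3.Theorems

namespace APL

open MeasureTheory Literature.Probability.Percolation Literature.Probability.LatticeModels
open scoped Classical

/-! ### Fibres of `T_b`, the three determining classes, and the cluster Markov factorisation -/

section Fibres

variable {n : ℕ} (w : Sym2 (Fin n) → unitInterval) (S : Finset (Fin n)) (b c : Fin n)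

/-- `{T_b = T}` is determined by the pairs inside `Sᶜ` meeting `T` (`b ∈ T`). [folklore] -/
theorem determinedBy_fibS (T : Finset (Fin n)) (hbT : b ∈ T) :
    DeterminedBy {ω : BondConfig (Fin n) |
        openCluster (ω ∩ {e | ∀ x ∈ e, x ∉ (S : Set (Fin n))}) b = (T : Set (Fin n))}
      (↑(Finset.univ.filter fun e : Sym2 (Fin n) => (∃ x ∈ T, x ∈ e) ∧ ∀ x ∈ e, x ∉ S) :
        Set (Sym2 (Fin n))) := by
  have h := determinedBy_of_restrict {e : Sym2 (Fin n) | ∀ x ∈ e, x ∉ (S : Set (Fin n))}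
    (goodPM_determinedBy_cluster_eq b T hbT)
  refine DeterminedBy.mono (A := {ω : BondConfig (Fin n) |
    openCluster (ω ∩ {e | ∀ x ∈ e, x ∉ (S : Set (Fin n))}) b = (T : Set (Fin n))}) h ?_
  rintro e ⟨he1, he2⟩
  rw [Finset.coe_filter] at he1 ⊢
  exact ⟨Finset.mem_univ _, he1.2, fun x hx hxS => he2 x hx (Finset.mem_coe.2 hxS)⟩

/-- `{the apex set has an open pair into T}` is determined by those pairs. [folklore] -/
theorem determinedBy_attach (T : Finset (Fin n)) :
    DeterminedBy {ω : BondConfig (Fin n) | ∃ s ∈ (S : Set (Fin n)), ∃ t ∈ (T : Set (Fin n)), s(s, t) ∈ ω}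
      (↑(Finset.univ.filter fun e : Sym2 (Fin n) => ∃ s ∈ S, ∃ t ∈ T, e = s(s, t)) : Set (Sym2 (Fin n))) := by
  rw [determinedBy_iff]
  intro ω ω' hω
  simp only [Set.mem_setOf_eq]
  refine exists_congr fun s => and_congr_right fun hs => exists_congr fun t => and_congr_right fun ht => ?_
  have he : s(s, t) ∈ (↑(Finset.univ.filter fun e : Sym2 (Fin n) => ∃ s ∈ S, ∃ t ∈ T, e = s(s, t)) :
      Set (Sym2 (Fin n))) := by
    rw [Finset.coe_filter]
    exact ⟨Finset.mem_univ _, s, Finset.mem_coe.1 hs, t, Finset.mem_coe.1 ht, rfl⟩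
  exact ⟨fun h1 => ((Set.ext_iff.1 hω _).1 ⟨h1, he⟩).1, fun h1 => ((Set.ext_iff.1 hω _).2 ⟨h1, he⟩).1⟩

/-- `{the apex set has an open pair into the cluster of c among the pairs inside Sᶜ ∖ T}` is determined by the pairs
avoiding `T` with a vertex outside `S` (`T ∩ S = ∅`, `c ∉ S ∪ T`). [folklore] -/
theorem determinedBy_attachCluster (T : Finset (Fin n)) (hTS : ∀ x ∈ T, x ∉ S) (hcS : c ∉ S) (hcT : c ∉ T) :
    DeterminedBy {ω : BondConfig (Fin n) | ∃ s ∈ (S : Set (Fin n)), ∃ t ∈ openCluster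
        (ω ∩ {e | ∀ x ∈ e, x ∉ (S : Set (Fin n))} ∩ {e | ∀ x ∈ e, x ∉ (T : Set (Fin n))}) c, s(s, t) ∈ ω}
      (↑(Finset.univ.filter fun e : Sym2 (Fin n) => (∀ x ∈ e, x ∉ T) ∧ ∃ x ∈ e, x ∉ S) : Set (Sym2 (Fin n))) := by
  rw [determinedBy_iff]
  intro ω ω' hω
  set P : Set (Sym2 (Fin n)) := ↑(Finset.univ.filter fun e : Sym2 (Fin n) => (∀ x ∈ e, x ∉ T) ∧ ∃ x ∈ e, x ∉ S)
    with hP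
  set E : Set (Sym2 (Fin n)) := {e : Sym2 (Fin n) | ∀ x ∈ e, x ∉ (S : Set (Fin n))} ∩
    {e | ∀ x ∈ e, x ∉ (T : Set (Fin n))} with hEdef
  -- the restricted configurations agree
  have hE : E ⊆ P := by
    rintro e ⟨h1, h2⟩
    rw [hP, Finset.coe_filter]
    refine ⟨Finset.mem_univ _, fun x hx hxT => h2 x hx (Finset.mem_coe.2 hxT), ?_⟩
    induction e using Sym2.ind with
    | h u v => exact ⟨u, Sym2.mem_mk_left u v, fun hu => h1 u (Sym2.mem_mk_left u v) (Finset.mem_coe.2 hu)⟩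
  have hres : ω ∩ E = ω' ∩ E := by
    have h1 : ω ∩ E = (ω ∩ P) ∩ E := by
      rw [Set.inter_assoc, Set.inter_eq_self_of_subset_right hE]
    have h2 : ω' ∩ E = (ω' ∩ P) ∩ E := by
      rw [Set.inter_assoc, Set.inter_eq_self_of_subset_right hE]
    rw [h1, h2, hω]
  have hωE : ω ∩ {e : Sym2 (Fin n) | ∀ x ∈ e, x ∉ (S : Set (Fin n))} ∩ {e | ∀ x ∈ e, x ∉ (T : Set (Fin n))} = ω ∩ E := by
    rw [hEdef, Set.inter_assoc]
  have hω'E : ω' ∩ {e : Sym2 (Fin n) | ∀ x ∈ e, x ∉ (S : Set (Fin n))} ∩ {e | ∀ x ∈ e, x ∉ (T : Set (Fin n))} =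
      ω' ∩ E := by
    rw [hEdef, Set.inter_assoc]
  simp only [Set.mem_setOf_eq]
  rw [hωE, hω'E, hres]
  refine exists_congr fun s => and_congr_right fun hs => exists_congr fun t => and_congr_right fun ht => ?_
  -- `t ∉ T` and `t ∉ S`
  have ht' : t ∈ openCluster ((ω' ∩ {e : Sym2 (Fin n) | ∀ x ∈ e, x ∉ (S : Set (Fin n))}) ∩
      {e | ∀ x ∈ e, x ∉ (T : Set (Fin n))}) c := by rw [hEdef, ← Set.inter_assoc] at ht; exact ht
  have htT : t ∉ (T : Set (Fin n)) := offSet_not_mem (fun h => hcT (Finset.mem_coe.1 h)) ht'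
  have ht'' : t ∈ openCluster ((ω' ∩ {e : Sym2 (Fin n) | ∀ x ∈ e, x ∉ (T : Set (Fin n))}) ∩
      {e | ∀ x ∈ e, x ∉ (S : Set (Fin n))}) c := by rw [Set.inter_right_comm] at ht'; exact ht'
  have htS : t ∉ (S : Set (Fin n)) := offSet_not_mem (fun h => hcS (Finset.mem_coe.1 h)) ht''
  have he : s(s, t) ∈ P := by
    rw [hP, Finset.coe_filter]
    refine ⟨Finset.mem_univ _, fun x hx hxT => ?_, t, Sym2.mem_mk_right s t, fun htS' => htS (Finset.mem_coe.2 htS')⟩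
    rcases Sym2.mem_iff.1 hx with h | h
    · exact hTS x hxT (h ▸ Finset.mem_coe.1 hs)
    · exact htT (h ▸ Finset.mem_coe.2 hxT)
  exact ⟨fun h1 => ((Set.ext_iff.1 hω _).1 ⟨h1, he⟩).1, fun h1 => ((Set.ext_iff.1 hω _).2 ⟨h1, he⟩).1⟩

/-- Disjointness of the three classes: pairs inside `Sᶜ` meeting `T`; pairs from `S` into `T`; pairs avoiding `T` with a vertex
outside `S`. [folklore] -/
theorem disjoint_fibS_attach (T : Finset (Fin n)) :
    Disjoint (Finset.univ.filter fun e : Sym2 (Fin n) => (∃ x ∈ T, x ∈ e) ∧ ∀ x ∈ e, x ∉ S)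
      ((Finset.univ.filter fun e : Sym2 (Fin n) => ∃ s ∈ S, ∃ t ∈ T, e = s(s, t)) ∪
        (Finset.univ.filter fun e : Sym2 (Fin n) => (∀ x ∈ e, x ∉ T) ∧ ∃ x ∈ e, x ∉ S)) := by
  rw [Finset.disjoint_left]
  intro e he he'
  obtain ⟨⟨x, hxT, hxe⟩, heS⟩ := (Finset.mem_filter.1 he).2
  rcases Finset.mem_union.1 he' with h2 | h3
  · obtain ⟨s, hs, t, -, rfl⟩ := (Finset.mem_filter.1 h2).2
    exact heS s (Sym2.mem_mk_left s t) hs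
  · exact (Finset.mem_filter.1 h3).2.1 x hxe hxT

/-- Disjointness: pairs from `S` into `T` vs. pairs avoiding `T`. [folklore] -/
theorem disjoint_attach_attachCluster (T : Finset (Fin n)) :
    Disjoint (Finset.univ.filter fun e : Sym2 (Fin n) => ∃ s ∈ S, ∃ t ∈ T, e = s(s, t))
      (Finset.univ.filter fun e : Sym2 (Fin n) => (∀ x ∈ e, x ∉ T) ∧ ∃ x ∈ e, x ∉ S) := by
  rw [Finset.disjoint_left]
  intro e he h3
  obtain ⟨s, -, t, ht, rfl⟩ := (Finset.mem_filter.1 he).2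
  exact (Finset.mem_filter.1 h3).2.1 t (Sym2.mem_mk_right s t) ht

/-- **Cluster Markov factorisation on a fibre of `T_b`** (`b ∈ T`, `T ∩ S = ∅`, `c ∉ S ∪ T`):
`μ({T_b = T} ∩ Att_b(T) ∩ Att_c(T)) = μ(T_b = T) · μ(Att_b(T)) · μ(Att_c(T))`. [cite: VandenbergHaggstromKahn2005, Lemma 2.3] -/
theorem real_fibS_attach_attach (T : Finset (Fin n)) (hbT : b ∈ T) (hTS : ∀ x ∈ T, x ∉ S) (hcS : c ∉ S) (hcT : c ∉ T) :
    (prodBernoulli w).real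
        ({ω : BondConfig (Fin n) | openCluster (ω ∩ {e | ∀ x ∈ e, x ∉ (S : Set (Fin n))}) b = (T : Set (Fin n))} ∩
          ({ω | ∃ s ∈ (S : Set (Fin n)), ∃ t ∈ (T : Set (Fin n)), s(s, t) ∈ ω} ∩
            {ω | ∃ s ∈ (S : Set (Fin n)), ∃ t ∈ openCluster
              (ω ∩ {e | ∀ x ∈ e, x ∉ (S : Set (Fin n))} ∩ {e | ∀ x ∈ e, x ∉ (T : Set (Fin n))}) c, s(s, t) ∈ ω})) =
      (prodBernoulli w).real
          {ω : BondConfig (Fin n) | openCluster (ω ∩ {e | ∀ x ∈ e, x ∉ (S : Set (Fin n))}) b = (T : Set (Fin n))} *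
        ((prodBernoulli w).real {ω | ∃ s ∈ (S : Set (Fin n)), ∃ t ∈ (T : Set (Fin n)), s(s, t) ∈ ω} *
          (prodBernoulli w).real {ω | ∃ s ∈ (S : Set (Fin n)), ∃ t ∈ openCluster
              (ω ∩ {e | ∀ x ∈ e, x ∉ (S : Set (Fin n))} ∩ {e | ∀ x ∈ e, x ∉ (T : Set (Fin n))}) c, s(s, t) ∈ ω}) := by
  have hm : ∀ A : Set (BondConfig (Fin n)), MeasurableSet A := fun A => MeasurableSet.of_discrete
  rw [prodBernoulli_real_inter_of_determinedBy_disjoint w (disjoint_fibS_attach S T)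
      (determinedBy_fibS S b T hbT) ?_ (hm _) (hm _)]
  · congr 1
    exact prodBernoulli_real_inter_of_determinedBy_disjoint w (disjoint_attach_attachCluster S T)
      (determinedBy_attach S T) (determinedBy_attachCluster S c T hTS hcS hcT) (hm _) (hm _)
  · rw [Finset.coe_union]
    exact ((determinedBy_attach S T).mono Set.subset_union_left).inter
      ((determinedBy_attachCluster S c T hTS hcS hcT).mono Set.subset_union_right)

/-- Variant with only the attachment into `T`. [cite: VandenbergHaggstromKahn2005, Lemma 2.3] -/
theorem real_fibS_attach (T : Finset (Fin n)) (hbT : b ∈ T) :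
    (prodBernoulli w).real
        ({ω : BondConfig (Fin n) | openCluster (ω ∩ {e | ∀ x ∈ e, x ∉ (S : Set (Fin n))}) b = (T : Set (Fin n))} ∩
          {ω | ∃ s ∈ (S : Set (Fin n)), ∃ t ∈ (T : Set (Fin n)), s(s, t) ∈ ω}) =
      (prodBernoulli w).real
          {ω : BondConfig (Fin n) | openCluster (ω ∩ {e | ∀ x ∈ e, x ∉ (S : Set (Fin n))}) b = (T : Set (Fin n))} *
        (prodBernoulli w).real {ω | ∃ s ∈ (S : Set (Fin n)), ∃ t ∈ (T : Set (Fin n)), s(s, t) ∈ ω} := by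
  have hm : ∀ A : Set (BondConfig (Fin n)), MeasurableSet A := fun A => MeasurableSet.of_discrete
  exact prodBernoulli_real_inter_of_determinedBy_disjoint w
    ((disjoint_fibS_attach S T).mono_right Finset.subset_union_left)
    (determinedBy_fibS S b T hbT) (determinedBy_attach S T) (hm _) (hm _)

/-- Variant with only the attachment into the cluster of `c`. [cite: VandenbergHaggstromKahn2005, Lemma 2.3] -/
theorem real_fibS_attachCluster (T : Finset (Fin n)) (hbT : b ∈ T) (hTS : ∀ x ∈ T, x ∉ S) (hcS : c ∉ S)
    (hcT : c ∉ T) :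
    (prodBernoulli w).real
        ({ω : BondConfig (Fin n) | openCluster (ω ∩ {e | ∀ x ∈ e, x ∉ (S : Set (Fin n))}) b = (T : Set (Fin n))} ∩
          {ω | ∃ s ∈ (S : Set (Fin n)), ∃ t ∈ openCluster
              (ω ∩ {e | ∀ x ∈ e, x ∉ (S : Set (Fin n))} ∩ {e | ∀ x ∈ e, x ∉ (T : Set (Fin n))}) c, s(s, t) ∈ ω}) =
      (prodBernoulli w).real
          {ω : BondConfig (Fin n) | openCluster (ω ∩ {e | ∀ x ∈ e, x ∉ (S : Set (Fin n))}) b = (T : Set (Fin n))} *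
        (prodBernoulli w).real {ω | ∃ s ∈ (S : Set (Fin n)), ∃ t ∈ openCluster
              (ω ∩ {e | ∀ x ∈ e, x ∉ (S : Set (Fin n))} ∩ {e | ∀ x ∈ e, x ∉ (T : Set (Fin n))}) c, s(s, t) ∈ ω} := by
  have hm : ∀ A : Set (BondConfig (Fin n)), MeasurableSet A := fun A => MeasurableSet.of_discrete
  exact prodBernoulli_real_inter_of_determinedBy_disjoint w
    ((disjoint_fibS_attach S T).mono_right Finset.subset_union_right)
    (determinedBy_fibS S b T hbT) (determinedBy_attachCluster S c T hTS hcS hcT) (hm _) (hm _)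

/-- **Partition by the fibres of `T_b`**: `μ(F) = Σ_T μ({T_b = T} ∩ F)`. [folklore] -/
theorem real_eq_sum_fibS (F : Set (BondConfig (Fin n))) :
    (prodBernoulli w).real F = ∑ T : Finset (Fin n), (prodBernoulli w).real
      ({ω : BondConfig (Fin n) | openCluster (ω ∩ {e | ∀ x ∈ e, x ∉ (S : Set (Fin n))}) b = (T : Set (Fin n))} ∩ F) := by
  have h := sigmaRec_sum_preimage_inter w
    (fun ω => Finset.univ.filter fun v : Fin n => v ∈ openCluster (ω ∩ {e | ∀ x ∈ e, x ∉ (S : Set (Fin n))}) b) F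
  rw [← h]
  refine Finset.sum_congr rfl fun T _ => ?_
  congr 1
  ext ω
  simp only [Set.mem_inter_iff, Set.mem_preimage, Set.mem_singleton_iff]
  rw [← offObs_mem_fib_iff b T (ω ∩ {e | ∀ x ∈ e, x ∉ (S : Set (Fin n))})]
  rfl

/-! ### Fibre sums for the four quantities `m, A, G, X` -/

/-- A fibre `{T_b = T}` with `b ∉ T` or with `T` meeting `S` is empty. [folklore] -/
theorem fibS_eq_empty (T : Finset (Fin n)) (hb : b ∉ S) (h : b ∉ T ∨ ∃ x ∈ T, x ∈ S) :
    {ω : BondConfig (Fin n) | openCluster (ω ∩ {e | ∀ x ∈ e, x ∉ (S : Set (Fin n))}) b = (T : Set (Fin n))} = ∅ := by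
  ext ω
  simp only [Set.mem_setOf_eq, Set.mem_empty_iff_false, iff_false]
  intro hω
  rcases h with hbT | ⟨x, hxT, hxS⟩
  · have : b ∈ openCluster (ω ∩ {e | ∀ x ∈ e, x ∉ (S : Set (Fin n))}) b := mem_openCluster_self _ b
    rw [hω] at this
    exact hbT (Finset.mem_coe.1 this)
  · have hx : x ∈ openCluster (ω ∩ {e | ∀ x ∈ e, x ∉ (S : Set (Fin n))}) b := by
      rw [hω]; exact Finset.mem_coe.2 hxT
    exact offSet_not_mem (fun h => hb (Finset.mem_coe.1 h)) hx (Finset.mem_coe.2 hxS)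

/-- The generic fibre computation: for an event `E` that on the fibre `{T_b = T}` (`c ∉ T`) coincides with an event `E'` with
`μ({T_b = T} ∩ E') = μ(T_b = T) · v` (whenever `b ∈ T`, `T ∩ S = ∅`, `c ∉ T`), one has
`μ({T_b = T} ∩ ({c ∉ T_b} ∩ E)) = v · μ({T_b = T} ∩ {c ∉ T_b})`. [folklore] -/
theorem real_fibS_inter_offD (hb : b ∉ S) (T : Finset (Fin n)) {E E' : Set (BondConfig (Fin n))} {v : ℝ}
    (hEE' : ∀ ω, openCluster (ω ∩ {e | ∀ x ∈ e, x ∉ (S : Set (Fin n))}) b = (T : Set (Fin n)) →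
      c ∉ (T : Set (Fin n)) → (ω ∈ E ↔ ω ∈ E'))
    (hv : b ∈ T → (∀ x ∈ T, x ∉ S) → c ∉ T → (prodBernoulli w).real
        ({ω : BondConfig (Fin n) | openCluster (ω ∩ {e | ∀ x ∈ e, x ∉ (S : Set (Fin n))}) b = (T : Set (Fin n))} ∩ E') =
      (prodBernoulli w).real
          {ω : BondConfig (Fin n) | openCluster (ω ∩ {e | ∀ x ∈ e, x ∉ (S : Set (Fin n))}) b = (T : Set (Fin n))} * v) :
    (prodBernoulli w).real
        ({ω : BondConfig (Fin n) | openCluster (ω ∩ {e | ∀ x ∈ e, x ∉ (S : Set (Fin n))}) b = (T : Set (Fin n))} ∩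
          ({ω | c ∉ openCluster (ω ∩ {e | ∀ x ∈ e, x ∉ (S : Set (Fin n))}) b} ∩ E)) =
      v * (prodBernoulli w).real
          ({ω : BondConfig (Fin n) | openCluster (ω ∩ {e | ∀ x ∈ e, x ∉ (S : Set (Fin n))}) b = (T : Set (Fin n))} ∩
            {ω | c ∉ openCluster (ω ∩ {e | ∀ x ∈ e, x ∉ (S : Set (Fin n))}) b}) := by
  by_cases hgood : b ∈ T ∧ ∀ x ∈ T, x ∉ S
  · by_cases hcT : c ∈ T
    · -- the fibre misses `{c ∉ T_b}`
      have h0 : {ω : BondConfig (Fin n) | openCluster (ω ∩ {e | ∀ x ∈ e, x ∉ (S : Set (Fin n))}) b = (T : Set (Fin n))} ∩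
          {ω | c ∉ openCluster (ω ∩ {e | ∀ x ∈ e, x ∉ (S : Set (Fin n))}) b} = ∅ := by
        ext ω
        simp only [Set.mem_inter_iff, Set.mem_setOf_eq, Set.mem_empty_iff_false, iff_false, not_and, not_not]
        intro hω; rw [hω]; exact Finset.mem_coe.2 hcT
      rw [← Set.inter_assoc, h0, Set.empty_inter, measureReal_empty, mul_zero]
    · have h1 : {ω : BondConfig (Fin n) | openCluster (ω ∩ {e | ∀ x ∈ e, x ∉ (S : Set (Fin n))}) b = (T : Set (Fin n))} ∩
          ({ω | c ∉ openCluster (ω ∩ {e | ∀ x ∈ e, x ∉ (S : Set (Fin n))}) b} ∩ E) =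
          {ω : BondConfig (Fin n) | openCluster (ω ∩ {e | ∀ x ∈ e, x ∉ (S : Set (Fin n))}) b = (T : Set (Fin n))} ∩ E' := by
        ext ω
        simp only [Set.mem_inter_iff, Set.mem_setOf_eq]
        constructor
        · rintro ⟨hω, -, hE⟩
          exact ⟨hω, (hEE' ω hω (fun h => hcT (Finset.mem_coe.1 h))).1 hE⟩
        · rintro ⟨hω, hE'⟩
          refine ⟨hω, ?_, (hEE' ω hω (fun h => hcT (Finset.mem_coe.1 h))).2 hE'⟩
          rw [hω]; exact fun h => hcT (Finset.mem_coe.1 h)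
      have h2 : {ω : BondConfig (Fin n) | openCluster (ω ∩ {e | ∀ x ∈ e, x ∉ (S : Set (Fin n))}) b = (T : Set (Fin n))} ∩
          {ω | c ∉ openCluster (ω ∩ {e | ∀ x ∈ e, x ∉ (S : Set (Fin n))}) b} =
          {ω : BondConfig (Fin n) | openCluster (ω ∩ {e | ∀ x ∈ e, x ∉ (S : Set (Fin n))}) b = (T : Set (Fin n))} := by
        ext ω
        simp only [Set.mem_inter_iff, Set.mem_setOf_eq, and_iff_left_iff_imp]
        intro hω; rw [hω]; exact fun h => hcT (Finset.mem_coe.1 h)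
      rw [h1, h2, hv hgood.1 hgood.2 hcT, mul_comm]
  · -- empty fibre
    have hem := fibS_eq_empty S b T hb (by
      by_cases hbT : b ∈ T
      · right; by_contra hne; push Not at hne; exact hgood ⟨hbT, hne⟩
      · exact Or.inl hbT)
    rw [hem, Set.empty_inter, Set.empty_inter, measureReal_empty, mul_zero]

/-- `X = μ(c ∉ T_b, EX_b, EX_c) = Σ_T α(T)Γ(T) · μ(T_b = T, c ∉ T_b)`. [this work] -/
theorem real_offD_exb_exc_eq_sum (hb : b ∉ S) (hcS : c ∉ S) :
    (prodBernoulli w).real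
        ({ω : BondConfig (Fin n) | c ∉ openCluster (ω ∩ {e | ∀ x ∈ e, x ∉ (S : Set (Fin n))}) b} ∩
          ({ω | ∃ s ∈ (S : Set (Fin n)), ∃ t ∈ openCluster (ω ∩ {e | ∀ x ∈ e, x ∉ (S : Set (Fin n))}) b, s(s, t) ∈ ω} ∩
            {ω | ∃ s ∈ (S : Set (Fin n)), ∃ t ∈ openCluster (ω ∩ {e | ∀ x ∈ e, x ∉ (S : Set (Fin n))}) c, s(s, t) ∈ ω})) =
      ∑ T : Finset (Fin n), ((prodBernoulli w).real {ω | ∃ s ∈ (S : Set (Fin n)), ∃ t ∈ (T : Set (Fin n)), s(s, t) ∈ ω} *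
          (prodBernoulli w).real {ω | ∃ s ∈ (S : Set (Fin n)), ∃ t ∈ openCluster
              (ω ∩ {e | ∀ x ∈ e, x ∉ (S : Set (Fin n))} ∩ {e | ∀ x ∈ e, x ∉ (T : Set (Fin n))}) c, s(s, t) ∈ ω}) *
        (prodBernoulli w).real
          ({ω : BondConfig (Fin n) | openCluster (ω ∩ {e | ∀ x ∈ e, x ∉ (S : Set (Fin n))}) b = (T : Set (Fin n))} ∩
            {ω | c ∉ openCluster (ω ∩ {e | ∀ x ∈ e, x ∉ (S : Set (Fin n))}) b}) := by
  rw [real_eq_sum_fibS w S b]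
  refine Finset.sum_congr rfl fun T _ => ?_
  refine real_fibS_inter_offD w S b c hb T
    (E' := {ω | ∃ s ∈ (S : Set (Fin n)), ∃ t ∈ (T : Set (Fin n)), s(s, t) ∈ ω} ∩
      {ω | ∃ s ∈ (S : Set (Fin n)), ∃ t ∈ openCluster
        (ω ∩ {e | ∀ x ∈ e, x ∉ (S : Set (Fin n))} ∩ {e | ∀ x ∈ e, x ∉ (T : Set (Fin n))}) c, s(s, t) ∈ ω}) ?_ ?_
  · intro ω hω hcT
    simp only [Set.mem_inter_iff, Set.mem_setOf_eq]
    rw [offSet_cluster_eq_of_not_mem (show c ∉ openCluster (ω ∩ {e | ∀ x ∈ e, x ∉ (S : Set (Fin n))}) b by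
      rw [hω]; exact hcT), hω]
  · intro hbT hTS hcT
    exact real_fibS_attach_attach w S b c T hbT hTS hcS hcT

/-- `A = μ(c ∉ T_b, EX_b) = Σ_T α(T) · μ(T_b = T, c ∉ T_b)`. [this work] -/
theorem real_offD_exb_eq_sum (hb : b ∉ S) :
    (prodBernoulli w).real
        ({ω : BondConfig (Fin n) | c ∉ openCluster (ω ∩ {e | ∀ x ∈ e, x ∉ (S : Set (Fin n))}) b} ∩
          {ω | ∃ s ∈ (S : Set (Fin n)), ∃ t ∈ openCluster (ω ∩ {e | ∀ x ∈ e, x ∉ (S : Set (Fin n))}) b, s(s, t) ∈ ω}) =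
      ∑ T : Finset (Fin n), (prodBernoulli w).real {ω | ∃ s ∈ (S : Set (Fin n)), ∃ t ∈ (T : Set (Fin n)), s(s, t) ∈ ω} *
        (prodBernoulli w).real
          ({ω : BondConfig (Fin n) | openCluster (ω ∩ {e | ∀ x ∈ e, x ∉ (S : Set (Fin n))}) b = (T : Set (Fin n))} ∩
            {ω | c ∉ openCluster (ω ∩ {e | ∀ x ∈ e, x ∉ (S : Set (Fin n))}) b}) := by
  rw [real_eq_sum_fibS w S b]
  refine Finset.sum_congr rfl fun T _ => ?_
  refine real_fibS_inter_offD w S b c hb T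
    (E' := {ω | ∃ s ∈ (S : Set (Fin n)), ∃ t ∈ (T : Set (Fin n)), s(s, t) ∈ ω}) ?_ ?_
  · intro ω hω _
    simp only [Set.mem_setOf_eq]
    rw [hω]
  · intro hbT _ _
    exact real_fibS_attach w S b T hbT

/-- `G = μ(c ∉ T_b, EX_c) = Σ_T Γ(T) · μ(T_b = T, c ∉ T_b)`. [this work] -/
theorem real_offD_exc_eq_sum (hb : b ∉ S) (hcS : c ∉ S) :
    (prodBernoulli w).real
        ({ω : BondConfig (Fin n) | c ∉ openCluster (ω ∩ {e | ∀ x ∈ e, x ∉ (S : Set (Fin n))}) b} ∩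
          {ω | ∃ s ∈ (S : Set (Fin n)), ∃ t ∈ openCluster (ω ∩ {e | ∀ x ∈ e, x ∉ (S : Set (Fin n))}) c, s(s, t) ∈ ω}) =
      ∑ T : Finset (Fin n), (prodBernoulli w).real {ω | ∃ s ∈ (S : Set (Fin n)), ∃ t ∈ openCluster
              (ω ∩ {e | ∀ x ∈ e, x ∉ (S : Set (Fin n))} ∩ {e | ∀ x ∈ e, x ∉ (T : Set (Fin n))}) c, s(s, t) ∈ ω} *
        (prodBernoulli w).real
          ({ω : BondConfig (Fin n) | openCluster (ω ∩ {e | ∀ x ∈ e, x ∉ (S : Set (Fin n))}) b = (T : Set (Fin n))} ∩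
            {ω | c ∉ openCluster (ω ∩ {e | ∀ x ∈ e, x ∉ (S : Set (Fin n))}) b}) := by
  rw [real_eq_sum_fibS w S b]
  refine Finset.sum_congr rfl fun T _ => ?_
  refine real_fibS_inter_offD w S b c hb T
    (E' := {ω | ∃ s ∈ (S : Set (Fin n)), ∃ t ∈ openCluster
        (ω ∩ {e | ∀ x ∈ e, x ∉ (S : Set (Fin n))} ∩ {e | ∀ x ∈ e, x ∉ (T : Set (Fin n))}) c, s(s, t) ∈ ω}) ?_ ?_
  · intro ω hω hcT
    simp only [Set.mem_setOf_eq]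
    rw [offSet_cluster_eq_of_not_mem (show c ∉ openCluster (ω ∩ {e | ∀ x ∈ e, x ∉ (S : Set (Fin n))}) b by
      rw [hω]; exact hcT), hω]
  · intro hbT hTS hcT
    exact real_fibS_attachCluster w S b c T hbT hTS hcS hcT

/-- `m = μ(c ∉ T_b) = Σ_T μ(T_b = T, c ∉ T_b)`. [this work] -/
theorem real_offD_eq_sum :
    (prodBernoulli w).real {ω : BondConfig (Fin n) | c ∉ openCluster (ω ∩ {e | ∀ x ∈ e, x ∉ (S : Set (Fin n))}) b} =
      ∑ T : Finset (Fin n), (prodBernoulli w).real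
          ({ω : BondConfig (Fin n) | openCluster (ω ∩ {e | ∀ x ∈ e, x ∉ (S : Set (Fin n))}) b = (T : Set (Fin n))} ∩
            {ω | c ∉ openCluster (ω ∩ {e | ∀ x ∈ e, x ∉ (S : Set (Fin n))}) b}) :=
  real_eq_sum_fibS w S b _
end Fibres

end APL

end Summit.CriticalPhenomena.PercolationContinuityZ3.Theorems

end
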